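import Summits.CriticalPhenomena.PercolationContinuityZ3.Theorems.PercNearOneGluingNoHeavyLowerTailSahiLevelSplit
import Summits.CriticalPhenomena.PercolationContinuityZ3.Theorems.PercNearOneGluingNoHeavyLowerTailSahiClassTCoreStep
import Mathlib.Tactic.Linarith
import HarnessLib

/-!
# `NoHeavyLowerTail` (crux stmt-CriticalPhenomena-4575), P2 — the level-splitting inheritance in ENGINE FORM: a fifth peeling mechanism for the
# core induction, and Kahn's `C_3` for `|T₃| ≤ 1` triples with a dense pivotal set at ANY member

Support file (seat `prim-masterthm-p2`, gen 25; `--supports stmt-CriticalPhenomena-4575`), companion of `…SahiLevelSplit` (p370409).  No definition, no `sorry`,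
standard axioms.  Memo `run/shared/lean/prim/prim-masterthm/FROM-prim-masterthm-p2-g25-LEVEL-SPLIT.md`, SAHI-ROUTE.md §4.49.

* `sum_card_esupp_update_secAt_lt` — freezing one member at an `e`-section (`e` essential to it) strictly lowers the total essential support.
* **`sahiE_three_nonneg_of_levelDefect_step`** — if `e` is essential to `U (σ 0)` and the pivotal-density defect `D` of that member at `e` (partners
  `U (σ 1)`, `U (σ 2)`; `…SahiLevelSplit.ex_levelDefect_eq`) is `≥ 0`, then `E_3(μ_p; 1_U) ≥ 0` follows from `C_3` of all increasing triples of strictly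
  smaller total essential support — exactly the induction hypothesis handed out by `SahiClassTCube.sahiE_three_nonneg_of_core_step`.  With the structural
  faces of `…SahiLevelSplit` (shell inside a partner's bottom section, or inside the meet of the partners' top sections ⟹ `D ≥ 0` for every `p`) this is a
  hypothesis-free peeling step: among the 678 620 triples of the 4-cube with ≥ 2 triply-essential coordinates, 72.6 % peel at a triply-essential coordinate.
* **`sahiE_three_nonneg_of_T1_of_levelDefect_nonneg_perm`** — `|T₃| ≤ 1` (only `e` may be essential to all three members) and `D ≥ 0` for SOME member
  (given by `σ`) ⟹ `E_3(μ_p; 1_U) ≥ 0` (the frozen triples are class T).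
HONEST FRAMING: reductions and a stratum; Kahn's Conjecture 5 / `C_3` and its `|T₃| = 1` case remain OPEN. [this work]
-/

noncomputable section

open scoped Classical

namespace Summit.CriticalPhenomena.PercolationContinuityZ3.Theorems

namespace SahiLevelSplit

open Finset Function
open Literature.Combinatorics.Sahi2008
open Literature.Probability.Percolation.DecisionTree (ind ind_of_mem ind_of_not_mem ind_nonneg)

variable {ι : Type} [Fintype ι]

section Engine

variable (p : ι → unitInterval) (e : ι) (U : Fin 3 → Set (Set ι)) (hU : ∀ j, IsUpperSet (U j))
include hU

/-- Freezing member `j₀` at an `e`-section strictly lowers the total essential support when `e` is essential to `U j₀`. [this work] -/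
theorem sum_card_esupp_update_secAt_lt {j₀ : Fin 3} (he : e ∈ esupp (U j₀)) (b : Bool) :
    (∑ i, (esupp (Function.update U j₀ (secAt e b (U j₀)) i)).card) < ∑ i, (esupp (U i)).card := by
  refine Finset.sum_lt_sum (fun i _ => ?_) ⟨j₀, Finset.mem_univ _, ?_⟩
  · by_cases hi : i = j₀
    · subst hi; rw [Function.update_self]; exact SahiClassTCube.card_esupp_secAt_le (hU i) e b
    · rw [Function.update_of_ne hi]
  · rw [Function.update_self]; exact SahiClassTCube.card_esupp_secAt_lt (hU j₀) he b

/-- **ENGINE FORM (dense pivotal set ⟹ peel).**  If `e` is essential to the member `U (σ 0)` and that member's pivotal-density defect at `e` (partners `U (σ 1)`,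
`U (σ 2)`) is `≥ 0`, then `E_3(μ_p; 1_U) ≥ 0` follows from `C_3` of all increasing triples of strictly smaller total essential support — exactly the induction hypothesis
offered by `SahiClassTCube.sahiE_three_nonneg_of_core_step`.  In particular an ABSORBED SHELL (`levelDefect_nonneg_of_shell_subset_bottom/_tops`) at any essential
coordinate peels, for every `p`. [this work] -/
theorem sahiE_three_nonneg_of_levelDefect_step (σ : Equiv.Perm (Fin 3)) (he : e ∈ esupp (U (σ 0)))
    (hD : 0 ≤ ex (bernoulliWeight p) (fun ω =>
        (ind (secAt e true (U (σ 0))) ω - ind (secAt e false (U (σ 0))) ω) *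
          (2 * (ind (secAt e true (U (σ 1))) ω * ind (secAt e true (U (σ 2))) ω
                - ind (secAt e false (U (σ 1))) ω * ind (secAt e false (U (σ 2))) ω)
            - ex (bernoulliWeight p) (ind (U (σ 1))) * (ind (secAt e true (U (σ 2))) ω - ind (secAt e false (U (σ 2))) ω)
            - ex (bernoulliWeight p) (ind (U (σ 2))) * (ind (secAt e true (U (σ 1))) ω - ind (secAt e false (U (σ 1))) ω))))
    (IH : ∀ W : Fin 3 → Set (Set ι), (∀ j, IsUpperSet (W j)) → (∑ i, (esupp (W i)).card) < (∑ i, (esupp (U i)).card) →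
        0 ≤ sahiE (bernoulliWeight p) 3 (fun j => ind (W j))) :
    0 ≤ sahiE (bernoulliWeight p) 3 (fun j => ind (U j)) := by
  rw [← SahiClassTCube.sahiE_three_ind_comp_perm (bernoulliWeight p) σ U]
  have hvec : (fun i => ind (U (σ i))) = ![ind (U (σ 0)), ind (U (σ 1)), ind (U (σ 2))] := by
    funext i; fin_cases i <;> rfl
  rw [hvec]
  have hfrozen : ∀ b : Bool, 0 ≤ sahiE (bernoulliWeight p) 3 ![ind (secAt e b (U (σ 0))), ind (U (σ 1)), ind (U (σ 2))] := by
    intro b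
    let W : Fin 3 → Set (Set ι) := Function.update U (σ 0) (secAt e b (U (σ 0)))
    have hW : ∀ j, IsUpperSet (W j) := by
      intro j
      by_cases hj : j = σ 0
      · subst hj; simp only [W, Function.update_self]; exact isUpperSet_secAt e b (hU _)
      · simp only [W, Function.update_of_ne hj]; exact hU j
    have h := IH W hW (sum_card_esupp_update_secAt_lt e U hU he b)
    rw [← SahiClassTCube.sahiE_three_ind_comp_perm (bernoulliWeight p) σ W] at h
    have hvecW : (fun i => ind (W (σ i))) = ![ind (secAt e b (U (σ 0))), ind (U (σ 1)), ind (U (σ 2))] := by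
      funext i; fin_cases i <;> simp [W]
    rwa [hvecW] at h
  exact sahiE_three_nonneg_of_levelDefect_nonneg p e (U (σ 0)) (U (σ 1)) (U (σ 2)) hD (hfrozen false) (hfrozen true)

/-- **`|T₃| ≤ 1`, any member.**  If `e` is the only coordinate essential to all three members of `U` and the member `U (σ 0)` has pivotal-density defect `≥ 0`
at `e` (partners `U (σ 1)`, `U (σ 2)`), then `E_3(μ_p; 1_U) ≥ 0`. [this work] -/
theorem sahiE_three_nonneg_of_T1_of_levelDefect_nonneg_perm
    (hT1 : ∀ x, x ≠ e → ¬ (x ∈ esupp (U 0) ∧ x ∈ esupp (U 1) ∧ x ∈ esupp (U 2))) (σ : Equiv.Perm (Fin 3))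
    (hD : 0 ≤ ex (bernoulliWeight p) (fun ω =>
        (ind (secAt e true (U (σ 0))) ω - ind (secAt e false (U (σ 0))) ω) *
          (2 * (ind (secAt e true (U (σ 1))) ω * ind (secAt e true (U (σ 2))) ω
                - ind (secAt e false (U (σ 1))) ω * ind (secAt e false (U (σ 2))) ω)
            - ex (bernoulliWeight p) (ind (U (σ 1))) * (ind (secAt e true (U (σ 2))) ω - ind (secAt e false (U (σ 2))) ω)
            - ex (bernoulliWeight p) (ind (U (σ 2))) * (ind (secAt e true (U (σ 1))) ω - ind (secAt e false (U (σ 1))) ω)))) :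
    0 ≤ sahiE (bernoulliWeight p) 3 (fun j => ind (U j)) := by
  rw [← SahiClassTCube.sahiE_three_ind_comp_perm (bernoulliWeight p) σ U]
  have hvec : (fun i => ind (U (σ i))) = ![ind (U (σ 0)), ind (U (σ 1)), ind (U (σ 2))] := by
    funext i; fin_cases i <;> rfl
  rw [hvec]
  refine sahiE_three_nonneg_of_T1_of_levelDefect_nonneg p e (hU (σ 0)) (hU (σ 1)) (hU (σ 2)) (fun x hx hall => ?_) hD
  apply hT1 x hx
  have hall' : ∀ i : Fin 3, x ∈ esupp (U (σ i)) := fun i => by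
    fin_cases i
    · exact hall.1
    · exact hall.2.1
    · exact hall.2.2
  have hj : ∀ j : Fin 3, x ∈ esupp (U j) := fun j => by
    have h := hall' (σ.symm j)
    rwa [Equiv.apply_symm_apply] at h
  exact ⟨hj 0, hj 1, hj 2⟩

end Engine

end SahiLevelSplit

end Summit.CriticalPhenomena.PercolationContinuityZ3.Theorems
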